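import Literature.AlgebraicGeometry.ModuliOfAbelianVarieties.SiegelCMTorsionCongruence
import Literature.AlgebraicGeometry.ModuliOfAbelianVarieties.SiegelReciprocityContinuous
import Literature.NumberTheory.Automorphic.UnramifiedHeckeScalarsProofs
import HarnessLib

/-!
# The adelic orbit map `Θ_v : ∏ᵢ 𝔸_{Kᵢ,f} → 𝔸_{ℚ,f}^{2g}` of a CM structure is CONTINUOUS; «rational ⇒ adelic» for CM lattices
# ([Cassels–Fröhlich] II §14 (14.2) «algebraically and topologically»; [Shimura 1998] §18.3; [Deligne 1971] 4.16–4.20)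

Topic `AlgebraicGeometry/ModuliOfAbelianVarieties`; namespace `Literature.AlgebraicGeometry.ModuliOfAbelianVarieties.CMStructure`.
Cell hodgecm-mathlib (D-0151), fan B; a banked GENERIC leaf toward row I-7 (#60) `SiegelS1` (director s86 (2)(b)), on the #60 road
(MUMFORD-LINE-SPEC §3 step 5 / CENSUS-M3a (L5) «the completed-sandwich inclusion»): it discharges the ADELIC hypotheses `ha` /
`hlow` / `hup` of ★ R60-35 `SiegelCMLatticeReciprocity`, ★ R60-43 `SiegelCMTorsionCongruence` and the M3a-β «sandwich transport» from
their RATIONAL counterparts (`act(x)·v ∈ Λ_a ↔ / → / ← xᵢ ∈ 𝔞ᵢ`), WITHOUT a cyclicity hypothesis on `v` and WITHOUT any integral-basis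
computation.  THEOREMS ONLY (no definition, no named fact, no instance, no `sorry`; net Literature debt 0).  Sequel of ★ R60-14b
`SiegelCMStructureFreeRankOneAdelic` (`Θ_v` bijective for cyclic `v`), ★ R60-39 `SiegelReciprocityContinuous` (`R` continuous) and
★ (σ4)-D `SiegelCanonicalModel` (`cmRepMatrix`).

## The argument (topology instead of coordinates)

Let `c` be a CM structure ([Deligne1971TravauxShimura] 4.18: `act : F = ∏ᵢ Kᵢ ↪ End_ℚ(ℚ^{2g})`), `R(u) = c.cmRepMatrix u` the
`𝔸_{ℚ,f}`-linear extension of `act` to `F ⊗ 𝔸_{ℚ,f} = ∏ᵢ 𝔸_{Kᵢ,f}` acting on `𝔸_{ℚ,f}^{2g}`, and for `v ∈ ℚ^{2g}`,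
`a ∈ GL_{2g}(𝔸_{ℚ,f})` let `Θ'(u) := a⁻¹ · R(u) · (v ⊗ 1)` (the orbit map read in the basis `a`).
* §1–§2 `R` is `𝔸_{ℚ,f}`-LINEAR in `u` (`cmRepMatrix_smul`; additivity is ★ R60-43 `cmRepMatrix_add`; the identification
  `e_K : 𝔸_{ℚ,f} ⊗_ℚ K ≅ 𝔸_{K,f}` is `𝔸_{ℚ,f}`-linear, ★ R60-39 `ratFiniteAdeleTensorEquiv_symm_smul`) and CONTINUOUS (★ R60-39
  `continuous_cmRepMatrix`: `𝔸_{K,f}` is a finite `𝔸_{ℚ,f}`-module carrying the MODULE TOPOLOGY, ★ FLT-port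
  `IsModuleTopology 𝔸ᶠ[ℚ] 𝔸ᶠ[K]` = the «topologically» clause of (14.2)), so `Θ'` is continuous and the set
  `S = {u | Θ'(u) ∈ ẑ^{2g}} = Θ_v⁻¹(a·ẑ^{2g})` is an OPEN additive subgroup of `∏ᵢ 𝔸_{Kᵢ,f}`
  (`isOpen_setOf_forall_mulVec_cmRepMatrix_mulVec_mem`, ★ `isOpen_integralFiniteAdeles`).
* §3 APPROXIMATION: `F` is dense in `∏ᵢ 𝔸_{Kᵢ,f}` in the strong form «for every neighbourhood `U` of `0` and non-zero fractional
  ideals `𝔞ᵢ`, every `u` is `x ⊗ 1 + w` with `x ∈ F`, `w ∈ U` and `wᵢ ∈ 𝔞̂ᵢ`» (ideal boxes are cofinal among neighbourhoods of `0`,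
  ★ `FiniteAdeleRing.exists_forall_valued_le_idealRadius_imp_mem`; `𝔸_{K,f} = K + 𝔠̂` for every `𝔠 ≠ 0`,
  ★ `IdeleAction.exists_sub_algebraMap_mem_idealAdeles` = [Shimura1998] §18.3 «weak approximation»).
* §4 «RATIONAL ⇒ ADELIC»: if `xᵢ ∈ 𝔞ᵢ (∀ i) ⇒ act(x)·v ∈ Λ_a` for all `x ∈ F` then `uᵢ ∈ 𝔞̂ᵢ (∀ i) ⇒ Θ'(u) ∈ ẑ^{2g}` for all
  `u` (`S` is an open — hence closed — subgroup containing `⊕𝔞ᵢ`, whose closure contains `∏𝔞̂ᵢ`); if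
  `act(x)·v ∈ Λ_a ⇒ xᵢ ∈ 𝔞ᵢ` then `Θ'(u) ∈ ẑ^{2g} ⇒ uᵢ ∈ 𝔞̂ᵢ` (approximate `u ∈ S` by `x ∈ F` inside `S ∩ ∏𝔞̂ᵢ`-cosets).  These
  ONE-SIDED forms are what a lattice SANDWICH `⊕𝔞ᵢ ⊆ q_v⁻¹(Λ_a) ⊆ ⊕𝔟ᵢ` (★ R60-40a, CM by an order of `F`) feeds to the M3a-β
  «sandwich transport» (`hlow` at `𝔞`, `hup` at `𝔟`); the two-sided `iff` (hypothesis `ha` of ★ R60-35 :111) from the rational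
  `iff` is ★ R60-35b `SiegelCMLatticeReciprocityConverse.forall_inv_mulVec_mem_iff_of_rational` (A-p03, via bounded denominators) and
  also follows by combining the two theorems here.  Milne's «`(gΛ) ⊗ ẑ = g(Λ ⊗ ẑ)`» / Deligne's «`T(B) = k⁻¹(V_ẑ)`» read through
  the CM algebra: the completed lattice of `[J, a]` in `F ⊗ 𝔸_f` is determined by the rational lattice `q_v⁻¹(Λ_a) ⊂ F`.
[Milne2005ShimuraVarieties] §4 pp. 48–49; [Deligne1971TravauxShimura] 4.16 p. 150, proof of 4.21 (a) p. 152; [Shimura1998] §18.3 p. 122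
(`M_𝔭 = M ⊗ ℤ_𝔭`, «`M/𝔞 ≅ ⊕ M_𝔭/𝔞_𝔭`»).  Nothing printed is asserted; HC_CM is proved only modulo the 7 printed citations until rung 0 closes.

## References
* [CasselsFrohlichANT1967] J. W. S. Cassels, A. Fröhlich (eds.), *Algebraic Number Theory* (1967), Ch. II §14 Lemma (14.2).
* [Shimura1998] G. Shimura, *Abelian Varieties with Complex Multiplication and Modular Functions* (1998), §18.3 pp. 121–123.
* [Milne2005ShimuraVarieties] J. S. Milne, *Introduction to Shimura varieties* (2005), §4 pp. 48–49, Thm. 6.11 p. 74.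
* [Deligne1971TravauxShimura] P. Deligne, *Travaux de Shimura*, Sém. Bourbaki 389 (1971), 4.16–4.21 pp. 150–152.
* [FLTProject2025] K. Buzzard et al., FLT project, `FLT/DedekindDomain/FiniteAdeleRing/BaseChange.lean` (module topology on `𝔸_L^∞`).
-/

set_option autoImplicit false

noncomputable section

open scoped TensorProduct NumberField NumberField.AdeleRing nonZeroDivisors
open Module Function NumberField Matrix IsDedekindDomain Topology Filter

namespace Literature.AlgebraicGeometry.ModuliOfAbelianVarieties

namespace CMStructure

open Literature.NumberTheory.ComplexMultiplication (ratFiniteAdeleTensorEquiv)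
open Literature.NumberTheory.Automorphic (integralFiniteAdeles isOpen_integralFiniteAdeles idealRadius)
open Literature.NumberTheory.NumberFields.IdeleAction
  (idealAdeles mem_idealAdeles_iff idealAdeles_mono algebraMap_mem_idealAdeles_iff exists_sub_algebraMap_mem_idealAdeles)
open Literature.NumberTheory.Adeles (latticeOfGL mem_latticeOfGL_iff)

variable {g : ℕ} {δ : Fin g → ℕ} {ι : Type} [Fintype ι] [DecidableEq ι] {K : ι → Type} [∀ i, Field (K i)]
  [∀ i, NumberField (K i)] [∀ i, IsCMField (K i)] (c : CMStructure g δ ι K)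

/-! ### §1. `R = cmRepMatrix` is `𝔸_{ℚ,f}`-linear -/

/-- **`R(r · u) = r · R(u)`** for `r ∈ 𝔸_{ℚ,f}`: the adelic representation of `F ⊗ 𝔸_{ℚ,f} = ∏ᵢ 𝔸_{Kᵢ,f}` on `𝔸_{ℚ,f}^{2g}`
through `act` is `𝔸_{ℚ,f}`-linear (it is the value of an `𝔸_{ℚ,f}`-algebra homomorphism at `(e_{Kᵢ}⁻¹ uᵢ)ᵢ`, ★ `cmRepMatrix_eq_algHom`,
and `e_{Kᵢ}⁻¹` is `𝔸_{ℚ,f}`-linear, ★ R60-39 `ratFiniteAdeleTensorEquiv_symm_smul`). [cite: Deligne1971TravauxShimura, 3.9 p. 140 and 4.18 p. 150] [cite: CasselsFrohlichANT1967, Ch. II §14 Lemma (14.2)] -/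
theorem cmRepMatrix_smul (r : finAdeleQ) (u : Π i, FiniteAdeleRing (𝓞 (K i)) (K i)) :
    c.cmRepMatrix (r • u) = r • c.cmRepMatrix u := by
  obtain ⟨Θ, hΘ⟩ := c.exists_algHom_extending_actMatrix
  rw [c.cmRepMatrix_eq_algHom Θ hΘ, c.cmRepMatrix_eq_algHom Θ hΘ, ← map_smul]
  congr 1
  funext i
  rw [Pi.smul_apply, Pi.smul_apply, ratFiniteAdeleTensorEquiv_symm_smul i]

/-- `R(0) = 0`. [cite: Deligne1971TravauxShimura, 3.9 p. 140] -/
theorem cmRepMatrix_zero : c.cmRepMatrix 0 = 0 := by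
  have h := c.cmRepMatrix_smul 0 0
  rwa [zero_smul, zero_smul] at h

/-! ### §2. Continuity (★ R60-39 `continuous_cmRepMatrix`): `S = Θ_v⁻¹(a·ẑ^{2g})` is an open subgroup -/

/-- **The orbit map read in the basis `a` is CONTINUOUS**: `u ↦ a⁻¹ · R(u) · w` is continuous on `∏ᵢ 𝔸_{Kᵢ,f}` for every
`w ∈ 𝔸_{ℚ,f}^{2g}` and every matrix `a⁻¹` — from ★ R60-39 `continuous_cmRepMatrix` (`𝔸_{Kᵢ,f}` carries the `𝔸_{ℚ,f}`-MODULE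
TOPOLOGY, ★ FLT-port `IsModuleTopology 𝔸ᶠ[ℚ] 𝔸ᶠ[Kᵢ]` = the «topologically» clause of [CasselsFrohlichANT1967] II (14.2), and
`R` is `𝔸_{ℚ,f}`-linear). [cite: CasselsFrohlichANT1967, Ch. II §14 Lemma (14.2)] -/
theorem continuous_mulVec_cmRepMatrix_mulVec (M : Matrix (Fin g ⊕ Fin g) (Fin g ⊕ Fin g) finAdeleQ) (w : Fin g ⊕ Fin g → finAdeleQ) :
    Continuous fun u : Π i, FiniteAdeleRing (𝓞 (K i)) (K i) => M *ᵥ (c.cmRepMatrix u *ᵥ w) :=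
  continuous_const.matrix_mulVec (c.continuous_cmRepMatrix.matrix_mulVec continuous_const)

/-- **`S = Θ_v⁻¹(a·ẑ^{2g})` is OPEN**: the set of `u ∈ ∏ᵢ 𝔸_{Kᵢ,f}` with `a⁻¹ R(u) (v ⊗ 1) ∈ ẑ^{2g}` is open (`ẑ ⊂ 𝔸_{ℚ,f}` is open,
★ `isOpen_integralFiniteAdeles`, and §2). [cite: CasselsFrohlichANT1967, Ch. II §14 Lemma (14.2)] [cite: Milne2005ShimuraVarieties, §4 pp. 48–49] -/
theorem isOpen_setOf_forall_mulVec_cmRepMatrix_mulVec_mem (M : Matrix (Fin g ⊕ Fin g) (Fin g ⊕ Fin g) finAdeleQ)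
    (w : Fin g ⊕ Fin g → finAdeleQ) :
    IsOpen {u : Π i, FiniteAdeleRing (𝓞 (K i)) (K i) | ∀ j, (M *ᵥ (c.cmRepMatrix u *ᵥ w)) j ∈ integralFiniteAdeles ℚ} := by
  have h : {u : Π i, FiniteAdeleRing (𝓞 (K i)) (K i) | ∀ j, (M *ᵥ (c.cmRepMatrix u *ᵥ w)) j ∈ integralFiniteAdeles ℚ} =
      (fun u => M *ᵥ (c.cmRepMatrix u *ᵥ w)) ⁻¹'
        Set.pi Set.univ (fun _ => (integralFiniteAdeles ℚ : Set finAdeleQ)) := by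
    ext u
    simp only [Set.mem_setOf_eq, Set.mem_preimage, Set.mem_univ_pi, SetLike.mem_coe]
  rw [h]
  exact (isOpen_set_pi Set.finite_univ fun _ _ => isOpen_integralFiniteAdeles ℚ).preimage
    (c.continuous_mulVec_cmRepMatrix_mulVec M w)


/-! ### §3. Approximation: ideal boxes are cofinal at `0`, and `F` is dense in `∏ᵢ 𝔸_{Kᵢ,f}` -/

omit [Fintype ι] [DecidableEq ι] [∀ i, IsCMField (K i)] in
/-- **Ideal boxes `∏ᵢ 𝔫̂ᵢ` are cofinal among the neighbourhoods of `0` in `∏ᵢ 𝔸_{Kᵢ,f}`**: every neighbourhood `U` of `0`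
contains `{w | wᵢ ∈ 𝔫̂ᵢ ∀ i}` for some non-zero integral ideals `𝔫ᵢ ⊆ 𝓞_{Kᵢ}` (factorwise ★
`FiniteAdeleRing.exists_forall_valued_le_idealRadius_imp_mem`: the fundamental system `∏_{v ∈ S} 𝔭_v^{e_v}𝒪_v × ∏_{v ∉ S} 𝒪_v`).
[cite: CasselsFrohlichANT1967, Ch. II §14 (fundamental system of neighbourhoods of `0`)] [cite: Shimura1998, §18.3 p. 122] -/
theorem exists_forall_mem_idealAdeles_imp_mem_of_mem_nhds {U : Set (Π i, FiniteAdeleRing (𝓞 (K i)) (K i))}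
    (hU : U ∈ 𝓝 (0 : Π i, FiniteAdeleRing (𝓞 (K i)) (K i))) :
    ∃ 𝔫 : Π i, Ideal (𝓞 (K i)), (∀ i, 𝔫 i ≠ 0) ∧
      ∀ w : Π i, FiniteAdeleRing (𝓞 (K i)) (K i),
        (∀ i, w i ∈ idealAdeles ((𝔫 i : Ideal (𝓞 (K i))) : FractionalIdeal (𝓞 (K i))⁰ (K i))) → w ∈ U := by
  rw [nhds_pi, Filter.mem_pi] at hU
  obtain ⟨I, -, t, ht, hIt⟩ := hU
  have h1 : ∀ i, ∃ 𝔫 : Ideal (𝓞 (K i)), 𝔫 ≠ 0 ∧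
      ∀ x : FiniteAdeleRing (𝓞 (K i)) (K i), (∀ v, Valued.v (x v) ≤ idealRadius (K i) v 𝔫) → x ∈ t i :=
    fun i => Literature.NumberTheory.Automorphic.FiniteAdeleRing.exists_forall_valued_le_idealRadius_imp_mem (K i) (ht i)
  choose 𝔫 h𝔫 hsub using h1
  exact ⟨𝔫, h𝔫, fun w hw => hIt fun i _ => hsub i (w i) fun v => (mem_idealAdeles_iff.1 (hw i)) v⟩

/-- **A non-zero fractional ideal inside both `𝔞` and `𝔫`**: for `𝔞 ≠ 0` fractional and `𝔫 ≠ 0` integral there is a fractional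
ideal `𝔠 ≠ 0` with `𝔠 ⊆ 𝔞` and `𝔠 ⊆ 𝔫` (write `𝔞 = a⁻¹𝔞₀` with `𝔞₀` integral, Mathlib `FractionalIdeal.exists_eq_spanSingleton_mul`,
and take `𝔠 = 𝔫𝔞₀`).  Private plumbing. [folklore] -/
private theorem exists_ne_zero_le_and_le_coeIdeal {L : Type} [Field L] [NumberField L] {𝔞 : FractionalIdeal (𝓞 L)⁰ L} (h𝔞 : 𝔞 ≠ 0)
    {𝔫 : Ideal (𝓞 L)} (h𝔫 : 𝔫 ≠ 0) :
    ∃ 𝔠 : FractionalIdeal (𝓞 L)⁰ L, 𝔠 ≠ 0 ∧ 𝔠 ≤ 𝔞 ∧ 𝔠 ≤ (𝔫 : FractionalIdeal (𝓞 L)⁰ L) := by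
  obtain ⟨a, aI, ha0, h𝔞eq⟩ := FractionalIdeal.exists_eq_spanSingleton_mul 𝔞
  have haI : aI ≠ 0 := by
    rintro rfl
    apply h𝔞
    rw [h𝔞eq, Submodule.zero_eq_bot, FractionalIdeal.coeIdeal_bot, mul_zero]
  have ha : algebraMap (𝓞 L) L a ≠ 0 := fun h => ha0 ((map_eq_zero_iff _ (FaithfulSMul.algebraMap_injective (𝓞 L) L)).1 h)
  refine ⟨((𝔫 * aI : Ideal (𝓞 L)) : FractionalIdeal (𝓞 L)⁰ L),
    FractionalIdeal.coeIdeal_ne_zero.2 (mul_ne_zero h𝔫 haI), ?_, (FractionalIdeal.coeIdeal_le_coeIdeal L).2 Ideal.mul_le_right⟩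
  refine ((FractionalIdeal.coeIdeal_le_coeIdeal L).2 Ideal.mul_le_left).trans fun y hy => ?_
  obtain ⟨y', hy', rfl⟩ := (FractionalIdeal.mem_coeIdeal (𝓞 L)⁰).1 hy
  rw [h𝔞eq]
  refine FractionalIdeal.mem_singleton_mul.2 ⟨algebraMap (𝓞 L) L (a * y'), ?_, ?_⟩
  · exact (FractionalIdeal.mem_coeIdeal (𝓞 L)⁰).2 ⟨a * y', aI.mul_mem_left a hy', rfl⟩
  · rw [map_mul, ← mul_assoc, inv_mul_cancel₀ ha, one_mul]

omit [Fintype ι] [DecidableEq ι] [∀ i, IsCMField (K i)] in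
/-- **APPROXIMATION — `F` is dense in `∏ᵢ 𝔸_{Kᵢ,f}`, compatibly with ideal boxes**: for non-zero fractional ideals `𝔞ᵢ` and every
neighbourhood `U` of `0`, every `u ∈ ∏ᵢ 𝔸_{Kᵢ,f}` is `x ⊗ 1 + w` with `x ∈ F = ∏ Kᵢ`, `w ∈ U` and `wᵢ ∈ 𝔞̂ᵢ` for all `i`
(`𝔸_{K,f} = K + 𝔠̂` for every `𝔠 ≠ 0`, ★ `IdeleAction.exists_sub_algebraMap_mem_idealAdeles` — [Shimura1998] §18.3 / [Silverman1994]
II §8 «weak approximation» — with `𝔠ᵢ ⊆ 𝔞ᵢ ∩ 𝔫ᵢ` for the ideal box `∏ 𝔫̂ᵢ ⊆ U` of the previous lemma).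
[cite: Shimura1998, §18.3 p. 122] [cite: CasselsFrohlichANT1967, Ch. II §14] -/
theorem exists_sub_algebraMap_mem_and_mem_idealAdeles {𝔞 : Π i, FractionalIdeal (𝓞 (K i))⁰ (K i)} (h𝔞 : ∀ i, 𝔞 i ≠ 0)
    {U : Set (Π i, FiniteAdeleRing (𝓞 (K i)) (K i))} (hU : U ∈ 𝓝 (0 : Π i, FiniteAdeleRing (𝓞 (K i)) (K i)))
    (u : Π i, FiniteAdeleRing (𝓞 (K i)) (K i)) :
    ∃ x : Π i, K i,
      (u - fun i => algebraMap (K i) (FiniteAdeleRing (𝓞 (K i)) (K i)) (x i)) ∈ U ∧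
        ∀ i, u i - algebraMap (K i) (FiniteAdeleRing (𝓞 (K i)) (K i)) (x i) ∈ idealAdeles (𝔞 i) := by
  obtain ⟨𝔫, h𝔫, hU'⟩ := exists_forall_mem_idealAdeles_imp_mem_of_mem_nhds hU
  have hc : ∀ i, ∃ 𝔠 : FractionalIdeal (𝓞 (K i))⁰ (K i), 𝔠 ≠ 0 ∧ 𝔠 ≤ 𝔞 i ∧
      𝔠 ≤ ((𝔫 i : Ideal (𝓞 (K i))) : FractionalIdeal (𝓞 (K i))⁰ (K i)) :=
    fun i => exists_ne_zero_le_and_le_coeIdeal (h𝔞 i) (h𝔫 i)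
  choose 𝔠 h𝔠0 h𝔠𝔞 h𝔠𝔫 using hc
  have hx : ∀ i, ∃ x : K i, u i - algebraMap (K i) (FiniteAdeleRing (𝓞 (K i)) (K i)) x ∈ idealAdeles (𝔠 i) :=
    fun i => exists_sub_algebraMap_mem_idealAdeles (h𝔠0 i) (u i)
  choose x hx using hx
  exact ⟨x, hU' _ fun i => idealAdeles_mono (h𝔠0 i) (h𝔠𝔫 i) (hx i),
    fun i => idealAdeles_mono (h𝔠0 i) (h𝔠𝔞 i) (hx i)⟩

/-! ### §4. «RATIONAL ⇒ ADELIC» for the CM lattices `Θ_v⁻¹(a·ẑ^{2g})` -/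

/-- **On rational elements**: `a⁻¹ R(x ⊗ 1) (v ⊗ 1) ∈ ẑ^{2g} ↔ act(x)·v ∈ Λ_a` (★ `cmRepMatrix_algebraMap_mulVec_algebraMap`, ★ R60-19
`mem_latticeOfGL_iff`). [cite: Milne2005ShimuraVarieties, §4 pp. 48–49] [cite: Deligne1971TravauxShimura, 4.16 p. 150] -/
theorem forall_inv_mulVec_cmRepMatrix_algebraMap_mem_iff (v : Fin g ⊕ Fin g → ℚ) (a : GL (Fin g ⊕ Fin g) finAdeleQ)
    (x : Π i, K i) :
    (∀ j, (((a⁻¹ : GL (Fin g ⊕ Fin g) finAdeleQ) : Matrix (Fin g ⊕ Fin g) (Fin g ⊕ Fin g) finAdeleQ) *ᵥ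
        (c.cmRepMatrix (fun i => algebraMap (K i) (FiniteAdeleRing (𝓞 (K i)) (K i)) (x i)) *ᵥ
          fun j => algebraMap ℚ finAdeleQ (v j))) j ∈ integralFiniteAdeles ℚ) ↔
      c.act x v ∈ latticeOfGL a := by
  rw [c.cmRepMatrix_algebraMap_mulVec_algebraMap, mem_latticeOfGL_iff]

/-- `Θ'` is additive: `a⁻¹ R(u + u') w = a⁻¹ R(u) w + a⁻¹ R(u') w`. [cite: Deligne1971TravauxShimura, 3.9 p. 140] -/
theorem mulVec_cmRepMatrix_add_mulVec (M : Matrix (Fin g ⊕ Fin g) (Fin g ⊕ Fin g) finAdeleQ)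
    (u u' : Π i, FiniteAdeleRing (𝓞 (K i)) (K i)) (w : Fin g ⊕ Fin g → finAdeleQ) :
    M *ᵥ (c.cmRepMatrix (u + u') *ᵥ w) = M *ᵥ (c.cmRepMatrix u *ᵥ w) + M *ᵥ (c.cmRepMatrix u' *ᵥ w) := by
  rw [c.cmRepMatrix_add, Matrix.add_mulVec, Matrix.mulVec_add]

/-- `Θ'` respects differences: `a⁻¹ R(u − u') w = a⁻¹ R(u) w − a⁻¹ R(u') w` (★ R60-43 `cmRepMatrix_sub`). [cite: Deligne1971TravauxShimura, 3.9 p. 140] -/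
theorem mulVec_cmRepMatrix_sub_mulVec (M : Matrix (Fin g ⊕ Fin g) (Fin g ⊕ Fin g) finAdeleQ)
    (u u' : Π i, FiniteAdeleRing (𝓞 (K i)) (K i)) (w : Fin g ⊕ Fin g → finAdeleQ) :
    M *ᵥ (c.cmRepMatrix (u - u') *ᵥ w) = M *ᵥ (c.cmRepMatrix u *ᵥ w) - M *ᵥ (c.cmRepMatrix u' *ᵥ w) := by
  rw [c.cmRepMatrix_sub, Matrix.sub_mulVec, Matrix.mulVec_sub]

/-- **«RATIONAL ⇒ ADELIC», lower inclusion** ([Milne2005ShimuraVarieties] §4 «`(gΛ) ⊗ ẑ = g(Λ ⊗ ẑ)`»; [Deligne1971TravauxShimura]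
proof of 4.21 (a) «`T(B) = k⁻¹(V_ẑ)`»): if every `x ∈ F` with `xᵢ ∈ 𝔞ᵢ (∀ i)` has `act(x)·v ∈ Λ_a = ℚ^{2g} ∩ a·ẑ^{2g}`
(i.e. `⊕ᵢ 𝔞ᵢ ⊆ q_v⁻¹(Λ_a)` — e.g. the lower half of the lattice sandwich ★ R60-40a), then every `u ∈ ∏ᵢ 𝔸_{Kᵢ,f}` with
`uᵢ ∈ 𝔞̂ᵢ (∀ i)` has `a⁻¹ R(u) (v ⊗ 1) ∈ ẑ^{2g}` (i.e. `∏ᵢ 𝔞̂ᵢ ⊆ Θ_v⁻¹(a·ẑ^{2g})`).  NO cyclicity of `v` is needed.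
Proof: `S = Θ_v⁻¹(a·ẑ^{2g})` is an open additive subgroup (§2); approximate `u` by `x ∈ F` with `u − x ⊗ 1 ∈ S ∩ ∏ 𝔞̂ᵢ` (§3);
then `xᵢ ∈ Kᵢ ∩ 𝔞̂ᵢ = 𝔞ᵢ` (★ `algebraMap_mem_idealAdeles_iff`), so `x ⊗ 1 ∈ S` by hypothesis and `u = x ⊗ 1 + (u − x ⊗ 1) ∈ S`.
This is the hypothesis `hlow` of the M3a-β «sandwich transport» and half of `ha` of ★ R60-35 :111.
[cite: Milne2005ShimuraVarieties, §4 pp. 48–49] [cite: Deligne1971TravauxShimura, 4.16 p. 150, proof of Thm. 4.21 (a) p. 152]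
[cite: Shimura1998, §18.3 p. 122] -/
theorem forall_inv_mulVec_mem_of_forall_mem_idealAdeles {v : Fin g ⊕ Fin g → ℚ} {a : GL (Fin g ⊕ Fin g) finAdeleQ}
    {𝔞 : Π i, FractionalIdeal (𝓞 (K i))⁰ (K i)} (h𝔞 : ∀ i, 𝔞 i ≠ 0)
    (hrat : ∀ x : Π i, K i, (∀ i, x i ∈ 𝔞 i) → c.act x v ∈ latticeOfGL a)
    (u : Π i, FiniteAdeleRing (𝓞 (K i)) (K i)) (hu : ∀ i, u i ∈ idealAdeles (𝔞 i)) :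
    ∀ j, ((((a⁻¹ : GL (Fin g ⊕ Fin g) finAdeleQ) : Matrix (Fin g ⊕ Fin g) (Fin g ⊕ Fin g) finAdeleQ) *ᵥ
        (c.cmRepMatrix u *ᵥ fun j => algebraMap ℚ finAdeleQ (v j))) j ∈ integralFiniteAdeles ℚ) := by
  set M : Matrix (Fin g ⊕ Fin g) (Fin g ⊕ Fin g) finAdeleQ :=
    (((a⁻¹ : GL (Fin g ⊕ Fin g) finAdeleQ) : Matrix (Fin g ⊕ Fin g) (Fin g ⊕ Fin g) finAdeleQ)) with hM
  set w : Fin g ⊕ Fin g → finAdeleQ := fun j => algebraMap ℚ finAdeleQ (v j) with hw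
  set S : Set (Π i, FiniteAdeleRing (𝓞 (K i)) (K i)) :=
    {u | ∀ j, (M *ᵥ (c.cmRepMatrix u *ᵥ w)) j ∈ integralFiniteAdeles ℚ} with hS
  have hS0 : S ∈ 𝓝 (0 : Π i, FiniteAdeleRing (𝓞 (K i)) (K i)) := by
    refine (c.isOpen_setOf_forall_mulVec_cmRepMatrix_mulVec_mem M w).mem_nhds fun j => ?_
    rw [c.cmRepMatrix_zero, Matrix.zero_mulVec, Matrix.mulVec_zero]
    exact zero_mem _
  obtain ⟨x, hxS, hx𝔞⟩ := exists_sub_algebraMap_mem_and_mem_idealAdeles h𝔞 hS0 u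
  set xA : Π i, FiniteAdeleRing (𝓞 (K i)) (K i) := fun i => algebraMap (K i) (FiniteAdeleRing (𝓞 (K i)) (K i)) (x i) with hxA
  have hxi : ∀ i, x i ∈ 𝔞 i := fun i => by
    rw [← algebraMap_mem_idealAdeles_iff (h𝔞 i)]
    have e : algebraMap (K i) (FiniteAdeleRing (𝓞 (K i)) (K i)) (x i) = u i - (u - xA) i := by
      rw [Pi.sub_apply, hxA, sub_sub_cancel]
    rw [e]
    exact sub_mem (hu i) (hx𝔞 i)
  have hxS' : xA ∈ S := (c.forall_inv_mulVec_cmRepMatrix_algebraMap_mem_iff v a x).2 (hrat x hxi)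
  intro j
  have hu' : u = xA + (u - xA) := (add_sub_cancel xA u).symm
  rw [hu', c.mulVec_cmRepMatrix_add_mulVec, Pi.add_apply]
  exact add_mem (hxS' j) (hxS j)

/-- **«RATIONAL ⇒ ADELIC», lower inclusion WITH AN INTEGER SCALAR** (the shape of a lattice SANDWICH `N·⊕𝔟ᵢ ⊆ q_v⁻¹(Λ_a)`,
★ R60-40a; the hypothesis `hlowN` of ★ R60-48 §5 `act_zsmul_mem_latticeOfGL_mul_of_forall_mem_ideleMulIdeal` /
`forall_inv_mulVec_act_zsmul_sub_mem_of_forall_ideleMulEquiv`): if `act(N • x)·v ∈ Λ_a` for every `x ∈ ⊕ᵢ 𝔟ᵢ`, then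
`a⁻¹ R(N • u) (v ⊗ 1) ∈ ẑ^{2g}` for every `u ∈ ∏ᵢ 𝔟̂ᵢ` («`N·∏𝔟̂ᵢ ⊆ Θ_v⁻¹(a·ẑ^{2g})`»).  Same proof as the previous theorem, for the open
subgroup `{u | Θ'(N • u) ∈ ẑ^{2g}}`; NO cyclicity of `v` needed.
[cite: Shimura1998, §6.2 p. 42 («commensurable»); §18.3 p. 122] [cite: Milne2005ShimuraVarieties, §4 pp. 48–49]
[cite: Deligne1971TravauxShimura, 4.18 p. 150, proof of Thm. 4.21 (a) p. 152] -/
theorem forall_inv_mulVec_zsmul_mem_of_forall_mem_idealAdeles {v : Fin g ⊕ Fin g → ℚ} {a : GL (Fin g ⊕ Fin g) finAdeleQ}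
    {𝔟 : Π i, FractionalIdeal (𝓞 (K i))⁰ (K i)} (h𝔟 : ∀ i, 𝔟 i ≠ 0) (N : ℤ)
    (hrat : ∀ x : Π i, K i, (∀ i, x i ∈ 𝔟 i) → c.act (N • x) v ∈ latticeOfGL a)
    (u : Π i, FiniteAdeleRing (𝓞 (K i)) (K i)) (hu : ∀ i, u i ∈ idealAdeles (𝔟 i)) :
    ∀ j, ((((a⁻¹ : GL (Fin g ⊕ Fin g) finAdeleQ) : Matrix (Fin g ⊕ Fin g) (Fin g ⊕ Fin g) finAdeleQ) *ᵥ
        (c.cmRepMatrix (N • u) *ᵥ fun j => algebraMap ℚ finAdeleQ (v j))) j ∈ integralFiniteAdeles ℚ) := by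
  set M : Matrix (Fin g ⊕ Fin g) (Fin g ⊕ Fin g) finAdeleQ :=
    (((a⁻¹ : GL (Fin g ⊕ Fin g) finAdeleQ) : Matrix (Fin g ⊕ Fin g) (Fin g ⊕ Fin g) finAdeleQ)) with hM
  set w : Fin g ⊕ Fin g → finAdeleQ := fun j => algebraMap ℚ finAdeleQ (v j) with hw
  set S : Set (Π i, FiniteAdeleRing (𝓞 (K i)) (K i)) :=
    {u | ∀ j, (M *ᵥ (c.cmRepMatrix (N • u) *ᵥ w)) j ∈ integralFiniteAdeles ℚ} with hS
  have hSopen : IsOpen S := by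
    have h : S = (fun u : Π i, FiniteAdeleRing (𝓞 (K i)) (K i) => N • u) ⁻¹'
        {u | ∀ j, (M *ᵥ (c.cmRepMatrix u *ᵥ w)) j ∈ integralFiniteAdeles ℚ} := by
      ext u
      simp only [hS, Set.mem_setOf_eq, Set.mem_preimage]
    rw [h]
    exact (c.isOpen_setOf_forall_mulVec_cmRepMatrix_mulVec_mem M w).preimage (continuous_const_smul N)
  have hS0 : S ∈ 𝓝 (0 : Π i, FiniteAdeleRing (𝓞 (K i)) (K i)) := by
    refine hSopen.mem_nhds fun j => ?_
    rw [smul_zero, c.cmRepMatrix_zero, Matrix.zero_mulVec, Matrix.mulVec_zero]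
    exact zero_mem _
  obtain ⟨x, hxS, hx𝔟⟩ := exists_sub_algebraMap_mem_and_mem_idealAdeles h𝔟 hS0 u
  set xA : Π i, FiniteAdeleRing (𝓞 (K i)) (K i) := fun i => algebraMap (K i) (FiniteAdeleRing (𝓞 (K i)) (K i)) (x i) with hxA
  have hxi : ∀ i, x i ∈ 𝔟 i := fun i => by
    rw [← algebraMap_mem_idealAdeles_iff (h𝔟 i)]
    have e : algebraMap (K i) (FiniteAdeleRing (𝓞 (K i)) (K i)) (x i) = u i - (u - xA) i := by
      rw [Pi.sub_apply, hxA, sub_sub_cancel]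
    rw [e]
    exact sub_mem (hu i) (hx𝔟 i)
  have hNx : N • xA = fun i => algebraMap (K i) (FiniteAdeleRing (𝓞 (K i)) (K i)) ((N • x) i) := by
    funext i
    rw [Pi.smul_apply, hxA, Pi.smul_apply, map_zsmul]
  have hxS' : xA ∈ S := by
    intro j
    have e : c.cmRepMatrix (N • xA) = c.cmRepMatrix (fun i => algebraMap (K i) (FiniteAdeleRing (𝓞 (K i)) (K i)) ((N • x) i)) := by
      rw [hNx]
    rw [e]
    exact (c.forall_inv_mulVec_cmRepMatrix_algebraMap_mem_iff v a (N • x)).2 (hrat x hxi) j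
  intro j
  have hu' : N • u = N • xA + N • (u - xA) := by rw [← smul_add, add_sub_cancel]
  rw [hu', c.mulVec_cmRepMatrix_add_mulVec, Pi.add_apply]
  exact add_mem (hxS' j) (hxS j)

/-- **«RATIONAL ⇒ ADELIC», upper inclusion**: if every `x ∈ F` with `act(x)·v ∈ Λ_a` has `xᵢ ∈ 𝔞ᵢ (∀ i)` (`q_v⁻¹(Λ_a) ⊆ ⊕ᵢ 𝔞ᵢ` —
e.g. the upper half of the lattice sandwich ★ R60-40a), then every `u` with `a⁻¹ R(u) (v ⊗ 1) ∈ ẑ^{2g}` has `uᵢ ∈ 𝔞̂ᵢ (∀ i)`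
(`Θ_v⁻¹(a·ẑ^{2g}) ⊆ ∏ᵢ 𝔞̂ᵢ`).  NO cyclicity of `v` is needed.  Proof: approximate `u ∈ S` (open subgroup, §2) by `x ∈ F` with
`u − x ⊗ 1 ∈ S ∩ ∏ 𝔞̂ᵢ` (§3); then `x ⊗ 1 ∈ S`, i.e. `act(x)·v ∈ Λ_a`, so `xᵢ ∈ 𝔞ᵢ`, `xᵢ ⊗ 1 ∈ 𝔞̂ᵢ` and `uᵢ = xᵢ ⊗ 1 + (u − x ⊗ 1)ᵢ ∈ 𝔞̂ᵢ`.
This is the hypothesis `hup` of the M3a-β «sandwich transport» and the other half of `ha` of ★ R60-35 :111.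
[cite: Milne2005ShimuraVarieties, §4 pp. 48–49] [cite: Deligne1971TravauxShimura, 4.16 p. 150, proof of Thm. 4.21 (a) p. 152]
[cite: Shimura1998, §18.3 p. 122] -/
theorem forall_mem_idealAdeles_of_forall_inv_mulVec_mem {v : Fin g ⊕ Fin g → ℚ} {a : GL (Fin g ⊕ Fin g) finAdeleQ}
    {𝔞 : Π i, FractionalIdeal (𝓞 (K i))⁰ (K i)} (h𝔞 : ∀ i, 𝔞 i ≠ 0)
    (hrat : ∀ x : Π i, K i, c.act x v ∈ latticeOfGL a → ∀ i, x i ∈ 𝔞 i)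
    (u : Π i, FiniteAdeleRing (𝓞 (K i)) (K i))
    (hu : ∀ j, ((((a⁻¹ : GL (Fin g ⊕ Fin g) finAdeleQ) : Matrix (Fin g ⊕ Fin g) (Fin g ⊕ Fin g) finAdeleQ) *ᵥ
        (c.cmRepMatrix u *ᵥ fun j => algebraMap ℚ finAdeleQ (v j))) j ∈ integralFiniteAdeles ℚ)) :
    ∀ i, u i ∈ idealAdeles (𝔞 i) := by
  set M : Matrix (Fin g ⊕ Fin g) (Fin g ⊕ Fin g) finAdeleQ :=
    (((a⁻¹ : GL (Fin g ⊕ Fin g) finAdeleQ) : Matrix (Fin g ⊕ Fin g) (Fin g ⊕ Fin g) finAdeleQ)) with hM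
  set w : Fin g ⊕ Fin g → finAdeleQ := fun j => algebraMap ℚ finAdeleQ (v j) with hw
  set S : Set (Π i, FiniteAdeleRing (𝓞 (K i)) (K i)) :=
    {u | ∀ j, (M *ᵥ (c.cmRepMatrix u *ᵥ w)) j ∈ integralFiniteAdeles ℚ} with hS
  have hS0 : S ∈ 𝓝 (0 : Π i, FiniteAdeleRing (𝓞 (K i)) (K i)) := by
    refine (c.isOpen_setOf_forall_mulVec_cmRepMatrix_mulVec_mem M w).mem_nhds fun j => ?_
    rw [c.cmRepMatrix_zero, Matrix.zero_mulVec, Matrix.mulVec_zero]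
    exact zero_mem _
  obtain ⟨x, hxS, hx𝔞⟩ := exists_sub_algebraMap_mem_and_mem_idealAdeles h𝔞 hS0 u
  set xA : Π i, FiniteAdeleRing (𝓞 (K i)) (K i) := fun i => algebraMap (K i) (FiniteAdeleRing (𝓞 (K i)) (K i)) (x i) with hxA
  have hxS' : xA ∈ S := by
    intro j
    have e : xA = u - (u - xA) := (sub_sub_cancel u xA).symm
    rw [e, c.mulVec_cmRepMatrix_sub_mulVec, Pi.sub_apply]
    exact sub_mem (hu j) (hxS j)
  have hxi : ∀ i, x i ∈ 𝔞 i := hrat x ((c.forall_inv_mulVec_cmRepMatrix_algebraMap_mem_iff v a x).1 hxS')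
  intro i
  have e : u i = xA i + (u - xA) i := by rw [Pi.sub_apply, add_sub_cancel]
  rw [e]
  exact add_mem ((algebraMap_mem_idealAdeles_iff (h𝔞 i)).2 (hxi i)) (hx𝔞 i)

end CMStructure

end Literature.AlgebraicGeometry.ModuliOfAbelianVarieties

end
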